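import Summits.BirchSwinnertonDyer.BirchSwinnertonDyer.Theorems.SignedLowerHalvesSprungLowerDivisibilityAtThreeIotaDoorContra
import Summits.BirchSwinnertonDyer.BirchSwinnertonDyer.Theorems.SignedLowerHalvesSprungLowerDivisibilityAtThreeKatoSporadicLedgerIota
import HarnessLib

/-!
# Crux `SprungLowerDivisibilityAtThree` (item stmt-BirchSwinnertonDyer-19875; twin route `PrintX8VSC`: cruxes K′ 23732 / C′ 23733), line
# `chromatic-common-zeros`: THE ORBIT FORM OF THE PRINT-KEYED `ι`-DOOR AND OF ITS RESIDUE — the door `k(𝔭) ≤ j(ι𝔭)` holds at `𝔭`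
# IFF it holds at the mirror prime `ι𝔭` IFF the ORBIT ZETA INDEX is at most the common-zero multiplicity, `k(𝔭) + k(ι𝔭) ≤ m(𝔭)`;
# the registered residue `j(ι𝔭) < k(𝔭)` is therefore a property of the `ι`-ORBIT (`m < k + k′`), and every sporadic common zero whose
# mirror prime carries NO zeta index is INSIDE the door

Cell `bsd-ssimc` (host), width seat `cruxlead-stmt-BirchSwinnertonDyer-19875-w2` (gen 12) under the 19875 LEAD; `--supports`
stmt-BirchSwinnertonDyer-19875 `--as helper`; theorems only (no `def`, no named fact, no instance); closes NO item. Print-keyed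
(CONTRAGREDIENT package `SharpFlatColemanKatoDataContra`, natural-keyed fine datum `Y′ : FineSelmerDualData κ γ⁻¹`) twin and
sharpening of the γ-keyed ledger files `…KatoSporadicLedgerIota` (w3 g6: `k + j` is `ι`-symmetric) for the REGISTERED one-stub line
skeletons of the twin cruxes (LEAD g7; door `ChromaticCommonZeros.iotaDoorContra_sporadic_of_heldPack_of_thm714`, residue stubs
`stub_iotaResidueContra` on 23732 / `stub_iotaResidueCyclotomicContra` on 23733).

Notation at a height-one `𝔭 ∌ p` of `Λ = ℤ_p⟦T⟧`, `ι𝔭 := PrimeSpectrum.comap (invol p) 𝔭`, joint contragredient package `I, Cs, Cf`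
(`Cs.Z = Cf.Z`): `k = ℓ_𝔭(I.H ⧸ Cs.Z)` (zeta index), `c^• = ℓ_𝔭(Λ ⧸ range C•.colMap)`, `j = min(c♯, c♭)` (local index),
`m = min(ℓ_𝔭 Λ/(Gs), ℓ_𝔭 Λ/(Gf))` for Néron-normalised `Gs, Gf` (common-zero multiplicity), `x′ = ℓ_𝔭 Y′.X`; primes: `k′ = k(ι𝔭)` etc.

* §1 `min_lengthAt_quotient_span_eq_zeta_add_localIndex_contra` (`m = k + j`, print keying, from the content identity `m^• = k + c^•`,
  `SharpFlatColemanKatoDataContra.lengthAt_quotient_span_eq_zeta_add_range`); `localIndex_ne_top_contra` (`j < ⊤`);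
  `zeta_add_localIndex_eq_comap_invol_contra_of_invol_mem`: **`k + j = k′ + j′`** off `(p)` whenever `(L♯, L♭)` is `ι`-stable (on X8 it is:
  `ClassX8.invol_mem_span_pair`, the colour-MIXING functional equation — the common-zero multiplicity `ℓ Λ/(L♯, L♭)` is `ι`-symmetric,
  `lengthAt_quotient_eq_comap_invol_of_invol_mem`, although neither colour's own zero set is).
* §2 THE ORBIT FORM (pure `ℕ∞` bookkeeping on §1; package level, `ι`-stability displayed): `iotaDoor_contra_iff_comap_invol`
  (**door(𝔭) ⟺ door(ι𝔭)**), `iotaDoor_contra_iff_zeta_add_zeta_comap_invol_le` (**door ⟺ `k + k′ ≤ m`**; with the orbit window `m ≤ k + k′`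
  of `…KatoSporadicLedgerOrbit` the door is the equality case), `iotaResidue_contra_iff_comap_invol` / `iotaResidue_contra_iff_lt_zeta_add_zeta_comap_invol`
  (**residue(𝔭) ⟺ residue(ι𝔭) ⟺ `m < k + k′`** — inside the residue BOTH `k, k′ ≥ 1`), `iotaDoor_contra_of_zeta_comap_invol_eq_zero`
  (**`k′ = 0 ⟹` door at `𝔭`**: a common zero whose mirror prime is prime to the index of Kato's zeta element is INSIDE the door).
Sequels (same seat): `…IotaDoorContraOrbitFine` (with the natural-keyed fine datum: door at the mirror / `k′ = 0` ⟹ K at `𝔭`; equality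
`j(ι𝔭) = k = x′` inside the door once Kato's upper bound is displayed; X8 input-free forms), `…IotaDoorContraOrbitTelescope` (the same over the
K′ binder telescope from any door of the registered shape), `PrintX8VSCIotaResidueContraOrbit` (K′ BY NAME ⟺ guard → ORBIT residue).

HONEST FRAMING: structure of the open residue, not progress on its content — nothing is discharged; the residue stubs, K′, C′, K1, leaf X8 and
BSD are NOT proved here; the door's inputs (PT functional model, Kato 12.4, Matar 1.1, Sprung Thm 7.14, the period unit at 3) are printed
theorems typed statement-only. WHAT IT SAYS for the planners / the disprover: the K′/C′ residue is the set of sporadic (resp. positive-level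
cyclotomic, `ι𝔭 = 𝔭`, door `2k ≤ m`) common-zero `ι`-ORBITS on which Kato's zeta index is carried by BOTH members and jointly EXCEEDS the
common-zero multiplicity; on every other common-zero orbit Kato's Main Conjecture 12.10 holds at both members from the guard alone.

References: [Kato2004Asterisque] Conj. 12.10 (p. 224), Thm. 12.4 (p. 221), Thm. 12.5/12.6 (p. 222), (17.13.1) (pp. 279–280); [Sprung2012]
Def. 6.1 (p. 1495), §7.1 Props. 7.3/7.6, Thm. 7.14 (3) (p. 1504), Main Conj. 7.21 (p. 1505); [Sprung2017] Thm. 4.13, Cor. 4.14;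
[GreenbergLNM1716] §1; [Matar2020] Thm. 1.1; [Wingberg1989] Cor. 2.5; [KuriharaPollack2007] Problem 3.2; tree: `…IotaDoorContra` (w3 g9),
`…IotaDoorContraClosedOfThm714` (LEAD g7), `…KatoSporadicLedgerIota` / `…KatoSporadicLedgerOrbit` (w3 g6).
-/

set_option linter.dupNamespace false
set_option autoImplicit false

noncomputable section

open scoped Classical NumberField MatrixGroups ModularForm

open NumberField IsDedekindDomain CongruenceSubgroup WeierstrassCurve Field
  Literature.NumberTheory.EllipticCurves Literature.NumberTheory.EllipticCurves.ModularForms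
  Literature.NumberTheory.EllipticCurves.ZpExtension Literature.NumberTheory.EllipticCurves.Sprung2017
  Literature.NumberTheory.EllipticCurves.Sprung2012 Literature.NumberTheory.EllipticCurves.Rank1Residual
  Literature.NumberTheory.EllipticCurves.IwasawaAlgebra Literature.NumberTheory.EllipticCurves.Kato2004
  Literature.NumberTheory.EllipticCurves.Module
  Summit.BirchSwinnertonDyer.BirchSwinnertonDyer.Theorems
  Summit.BirchSwinnertonDyer.BirchSwinnertonDyer.Theorems.SmallImageSignedMuDefect

namespace Summit.BirchSwinnertonDyer.BirchSwinnertonDyer.Theorems.ChromaticCommonZeros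

/-! ### §0 `ℕ∞` bookkeeping (private) -/

/-- From `k + j = k' + j'` in `ℕ∞` with all four finite: `k ≤ j' ↔ k' ≤ j`. [folklore] -/
private theorem ENat.orbit_le_iff_le_of_add_eq_add {k j k' j' : ℕ∞} (h : k + j = k' + j') (hk : k ≠ ⊤) (hj : j ≠ ⊤)
    (hk' : k' ≠ ⊤) (hj' : j' ≠ ⊤) : k ≤ j' ↔ k' ≤ j := by
  lift k to ℕ using hk
  lift j to ℕ using hj
  lift k' to ℕ using hk'
  lift j' to ℕ using hj'
  have h' : k + j = k' + j' := by exact_mod_cast h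
  constructor
  · intro hle; have hle' : k ≤ j' := by exact_mod_cast hle
    exact_mod_cast (show k' ≤ j by omega)
  · intro hle; have hle' : k' ≤ j := by exact_mod_cast hle
    exact_mod_cast (show k ≤ j' by omega)

/-- From `k + j = k' + j'` in `ℕ∞` with all four finite: `k ≤ j' ↔ k + k' ≤ k + j`. [folklore] -/
private theorem ENat.orbit_le_iff_add_le_add_of_add_eq_add {k j k' j' : ℕ∞} (h : k + j = k' + j') (hk : k ≠ ⊤) (hj : j ≠ ⊤)
    (hk' : k' ≠ ⊤) (hj' : j' ≠ ⊤) : k ≤ j' ↔ k + k' ≤ k + j := by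
  lift k to ℕ using hk
  lift j to ℕ using hj
  lift k' to ℕ using hk'
  lift j' to ℕ using hj'
  have h' : k + j = k' + j' := by exact_mod_cast h
  constructor
  · intro hle; have hle' : k ≤ j' := by exact_mod_cast hle
    exact_mod_cast (show k + k' ≤ k + j by omega)
  · intro hle; have hle' : k + k' ≤ k + j := by exact_mod_cast hle
    exact_mod_cast (show k ≤ j' by omega)

/-- From `k + j = 0 + j'` in `ℕ∞`: `k ≤ j'` (no finiteness needed). [folklore] -/
private theorem ENat.orbit_le_of_add_eq_zero_add {k j j' : ℕ∞} (h : k + j = 0 + j') : k ≤ j' := by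
  rw [zero_add] at h
  rw [← h]
  exact le_self_add

/-- `G ≠ 0` for a Néron-normalised `G` of a non-zero `L` with `ϖ ≠ 0` (private plumbing). [cite: Sprung2012, Def. 6.1 (p. 1495)] -/
private theorem normalised_ne_zero_orbit {p : ℕ} [Fact p.Prime] {ϖ : ℚ} (hϖ0 : ϖ ≠ 0) {L G : IwasawaAlgebra p} (hL : L ≠ 0)
    (hG : iwasawaToPowerSeries p G = PowerSeries.C ((ϖ : ℚ) : ℚ_[p]) * iwasawaToPowerSeries p L) : G ≠ 0 := by
  intro h0
  rw [h0, map_zero, eq_comm, mul_eq_zero] at hG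
  rcases hG with hC | hL'
  · have h1 : ((ϖ : ℚ) : ℚ_[p]) = 0 := by simpa using congrArg PowerSeries.constantCoeff hC
    exact hϖ0 (by exact_mod_cast h1)
  · exact hL (iwasawaToPowerSeries_injective p (by rw [hL', map_zero]))

/-! ### §1 `m = k + j` in print keying, and `k + j` is `ι`-symmetric -/

section Package

variable (W : WeierstrassCurve ℚ) [W.IsElliptic] (p : ℕ) [Fact p.Prime]
  [ContinuousSMul ℤ_[p] (W.tateModule p)] [Module.Free ℤ_[p] (W.tateModule p)]
  [Module.Finite ℤ_[p] (W.tateModule p)]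
  {N : ℕ} {f : CuspForm (Gamma0 N) 2} {ϖ : ℚ} {κ : ZpExtension ℚ p} {γ : absoluteGaloisGroup ℚ}
  {E : Type} [Field E] [Algebra ℚ E] {ι : AlgebraicClosure ℚ →ₐ[ℚ] AlgebraicClosure E} {ap : ℤ}
  {g : absoluteGaloisGroup E} {c : ℕ → localPoints W E} {I : IwasawaH1Data W p κ γ}

/-- **`m = k + j`, print keying:** for the JOINT contragredient package (`Cs.Z = Cf.Z`), both colours non-zero and Néron-normalised
(`Gs, Gf`), `E[p]` irreducible, at every height-one `𝔭`: `min(ℓ_𝔭 Λ/(Gs), ℓ_𝔭 Λ/(Gf)) = ℓ_𝔭(I.H ⧸ Cs.Z) + min_• ℓ_𝔭(Λ ⧸ range C•.colMap)`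
— the minimum of the two content identities `m^• = k + c^•` (`SharpFlatColemanKatoDataContra.lengthAt_quotient_span_eq_zeta_add_range`).
[cite: Sprung2012, Def. 6.1 (p. 1495), Thm. 7.14 (3) (p. 1504)] [cite: Kato2004Asterisque, Thm. 12.6 (p. 222)] -/
theorem min_lengthAt_quotient_span_eq_zeta_add_localIndex_contra
    (Cs : SharpFlatColemanKatoDataContra W p f ϖ κ γ ι ap g c Chroma.sharp I)
    (Cf : SharpFlatColemanKatoDataContra W p f ϖ κ γ ι ap g c Chroma.flat I) (hZ : Cs.Z = Cf.Z)
    (hirr : W.HasIrreducibleModPGaloisRep p) {Lsharp Lflat Gs Gf : IwasawaAlgebra p}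
    (hSP : IsSprungPair f p ap Lsharp Lflat) (hs : chromaticL Chroma.sharp Lsharp Lflat ≠ 0)
    (hfl : chromaticL Chroma.flat Lsharp Lflat ≠ 0)
    (hGs : iwasawaToPowerSeries p Gs =
      PowerSeries.C ((ϖ : ℚ) : ℚ_[p]) * iwasawaToPowerSeries p (chromaticL Chroma.sharp Lsharp Lflat))
    (hGf : iwasawaToPowerSeries p Gf =
      PowerSeries.C ((ϖ : ℚ) : ℚ_[p]) * iwasawaToPowerSeries p (chromaticL Chroma.flat Lsharp Lflat))
    (𝔭 : PrimeSpectrum (IwasawaAlgebra p)) (h𝔭 : 𝔭.asIdeal.height = 1) :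
    min (Module.lengthAt (IwasawaAlgebra p) (IwasawaAlgebra p ⧸ Ideal.span {Gs}) 𝔭)
        (Module.lengthAt (IwasawaAlgebra p) (IwasawaAlgebra p ⧸ Ideal.span {Gf}) 𝔭) =
      Module.lengthAt (IwasawaAlgebra p) (I.H ⧸ Cs.Z) 𝔭 +
        min (Module.lengthAt (IwasawaAlgebra p) (IwasawaAlgebra p ⧸ LinearMap.range Cs.colMap) 𝔭)
          (Module.lengthAt (IwasawaAlgebra p) (IwasawaAlgebra p ⧸ LinearMap.range Cf.colMap) 𝔭) := by
  rw [Cs.lengthAt_quotient_span_eq_zeta_add_range W p hirr hSP hs hGs 𝔭 h𝔭,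
    Cf.lengthAt_quotient_span_eq_zeta_add_range W p hirr hSP hfl hGf 𝔭 h𝔭, ← hZ, min_add_add_left]

/-- **The local index of a joint contragredient package is FINITE at every height-one prime** (`j ≤ c♯ ≤ m♯ < ⊤` for a non-zero
Néron-normalised `♯` colour, `E[p]` irreducible). [cite: Sprung2012, Def. 6.1 (p. 1495), Thm. 7.14 (3) (p. 1504)] -/
theorem localIndex_ne_top_contra
    (Cs : SharpFlatColemanKatoDataContra W p f ϖ κ γ ι ap g c Chroma.sharp I)
    (Cf : SharpFlatColemanKatoDataContra W p f ϖ κ γ ι ap g c Chroma.flat I)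
    (hirr : W.HasIrreducibleModPGaloisRep p) {Lsharp Lflat Gs : IwasawaAlgebra p}
    (hSP : IsSprungPair f p ap Lsharp Lflat) (hs : chromaticL Chroma.sharp Lsharp Lflat ≠ 0)
    (hGs : iwasawaToPowerSeries p Gs =
      PowerSeries.C ((ϖ : ℚ) : ℚ_[p]) * iwasawaToPowerSeries p (chromaticL Chroma.sharp Lsharp Lflat))
    (hGs0 : Gs ≠ 0) (𝔭 : PrimeSpectrum (IwasawaAlgebra p)) (h𝔭 : 𝔭.asIdeal.height = 1) :
    min (Module.lengthAt (IwasawaAlgebra p) (IwasawaAlgebra p ⧸ LinearMap.range Cs.colMap) 𝔭)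
        (Module.lengthAt (IwasawaAlgebra p) (IwasawaAlgebra p ⧸ LinearMap.range Cf.colMap) 𝔭) ≠ ⊤ := by
  have hm : Module.lengthAt (IwasawaAlgebra p) (IwasawaAlgebra p ⧸ Ideal.span {Gs}) 𝔭 ≠ ⊤ :=
    lengthAt_ne_top_of_isTorsionBy hGs0 (isTorsionBy_quotient_span_singleton Gs) 𝔭 (le_of_eq h𝔭)
  refine ne_top_of_le_ne_top hm ((min_le_left _ _).trans ?_)
  rw [Cs.lengthAt_quotient_span_eq_zeta_add_range W p hirr hSP hs hGs 𝔭 h𝔭]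
  exact le_add_self

/-- **`k + j` IS `ι`-SYMMETRIC off `(p)` IN PRINT KEYING whenever `(L♯, L♭)` is `ι`-stable** (joint contragredient package, both colours
non-zero and normalised, `ϖ ≠ 0`, `E[p]` irreducible; height-one `𝔭 ∌ p`):
`ℓ_𝔭(I.H ⧸ Cs.Z) + min_• ℓ_𝔭(Λ ⧸ range C•.colMap) = ℓ_{ι𝔭}(I.H ⧸ Cs.Z) + min_• ℓ_{ι𝔭}(Λ ⧸ range C•.colMap)` — both sides are the common-zero
multiplicity `ℓ Λ/(L♯, L♭)` (§1 and `min_lengthAt_quotient_span_normalised_eq_lengthAt_quotient_span_pair`), which is `ι`-symmetric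
(`lengthAt_quotient_eq_comap_invol_of_invol_mem`). Print-keyed twin of `zeta_add_localIndex_eq_comap_invol_of_invol_mem`.
[cite: Kato2004Asterisque, Thm. 12.6 (p. 222), (17.13.1) (p. 280)] [cite: Sprung2012, Def. 6.1, §7.1, Thm. 7.14 (3)] [cite: GreenbergLNM1716, §1] -/
theorem zeta_add_localIndex_eq_comap_invol_contra_of_invol_mem
    (Cs : SharpFlatColemanKatoDataContra W p f ϖ κ γ ι ap g c Chroma.sharp I)
    (Cf : SharpFlatColemanKatoDataContra W p f ϖ κ γ ι ap g c Chroma.flat I) (hZ : Cs.Z = Cf.Z)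
    (hirr : W.HasIrreducibleModPGaloisRep p) (hϖ : ϖ ≠ 0) {Lsharp Lflat Gs Gf : IwasawaAlgebra p}
    (hSP : IsSprungPair f p ap Lsharp Lflat) (hs0 : Lsharp ≠ 0) (hf0 : Lflat ≠ 0)
    (hGs : iwasawaToPowerSeries p Gs =
      PowerSeries.C ((ϖ : ℚ) : ℚ_[p]) * iwasawaToPowerSeries p (chromaticL Chroma.sharp Lsharp Lflat))
    (hGf : iwasawaToPowerSeries p Gf =
      PowerSeries.C ((ϖ : ℚ) : ℚ_[p]) * iwasawaToPowerSeries p (chromaticL Chroma.flat Lsharp Lflat))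
    (hJ : ∀ x ∈ Ideal.span ({Lsharp, Lflat} : Set (IwasawaAlgebra p)),
      invol p x ∈ Ideal.span ({Lsharp, Lflat} : Set (IwasawaAlgebra p)))
    (𝔭 : PrimeSpectrum (IwasawaAlgebra p)) (h𝔭 : 𝔭.asIdeal.height = 1)
    (hp𝔭 : (p : IwasawaAlgebra p) ∉ 𝔭.asIdeal) :
    Module.lengthAt (IwasawaAlgebra p) (I.H ⧸ Cs.Z) 𝔭 +
        min (Module.lengthAt (IwasawaAlgebra p) (IwasawaAlgebra p ⧸ LinearMap.range Cs.colMap) 𝔭)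
          (Module.lengthAt (IwasawaAlgebra p) (IwasawaAlgebra p ⧸ LinearMap.range Cf.colMap) 𝔭) =
      Module.lengthAt (IwasawaAlgebra p) (I.H ⧸ Cs.Z) (PrimeSpectrum.comap (invol p).toRingHom 𝔭) +
        min (Module.lengthAt (IwasawaAlgebra p) (IwasawaAlgebra p ⧸ LinearMap.range Cs.colMap)
            (PrimeSpectrum.comap (invol p).toRingHom 𝔭))
          (Module.lengthAt (IwasawaAlgebra p) (IwasawaAlgebra p ⧸ LinearMap.range Cf.colMap)
            (PrimeSpectrum.comap (invol p).toRingHom 𝔭)) := by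
  have hcs : chromaticL Chroma.sharp Lsharp Lflat ≠ 0 := by rwa [chromaticL_sharp]
  have hcf : chromaticL Chroma.flat Lsharp Lflat ≠ 0 := by rwa [chromaticL_flat]
  have h𝔮1 : (PrimeSpectrum.comap (invol p).toRingHom 𝔭).asIdeal.height = 1 := by
    rw [Kato2004.height_comap_invol, h𝔭]
  have hp𝔮 : (p : IwasawaAlgebra p) ∉ (PrimeSpectrum.comap (invol p).toRingHom 𝔭).asIdeal := by
    rwa [PrimeSpectrum.comap_asIdeal, Ideal.mem_comap, map_natCast]
  rw [← min_lengthAt_quotient_span_eq_zeta_add_localIndex_contra W p Cs Cf hZ hirr hSP hcs hcf hGs hGf 𝔭 h𝔭,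
    ← min_lengthAt_quotient_span_eq_zeta_add_localIndex_contra W p Cs Cf hZ hirr hSP hcs hcf hGs hGf _ h𝔮1,
    min_lengthAt_quotient_span_normalised_eq_lengthAt_quotient_span_pair p hϖ hs0 hf0 hGs hGf 𝔭 h𝔭 hp𝔭,
    min_lengthAt_quotient_span_normalised_eq_lengthAt_quotient_span_pair p hϖ hs0 hf0 hGs hGf _ h𝔮1 hp𝔮]
  exact lengthAt_quotient_eq_comap_invol_of_invol_mem _ hJ 𝔭

/-! ### §2 The orbit form of the door and of the residue (package algebra, `ι`-stability displayed) -/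

/-- **door(𝔭) ⟺ door(ι𝔭), print keying.** In the situation of `zeta_add_localIndex_eq_comap_invol_contra_of_invol_mem`:
`k(𝔭) ≤ j(ι𝔭) ↔ k(ι𝔭) ≤ j(𝔭)` — the `ι`-door of the K′/C′ line skeletons holds at a prime iff it holds at the mirror prime.
[cite: Kato2004Asterisque, Conj. 12.10 (p. 224), Thm. 12.6 (p. 222)] [cite: Sprung2012, §7.1, Thm. 7.14 (3)] [cite: GreenbergLNM1716, §1] -/
theorem iotaDoor_contra_iff_comap_invol
    (Cs : SharpFlatColemanKatoDataContra W p f ϖ κ γ ι ap g c Chroma.sharp I)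
    (Cf : SharpFlatColemanKatoDataContra W p f ϖ κ γ ι ap g c Chroma.flat I) (hZ : Cs.Z = Cf.Z)
    (hirr : W.HasIrreducibleModPGaloisRep p) (hϖ : ϖ ≠ 0) {Lsharp Lflat Gs Gf : IwasawaAlgebra p}
    (hSP : IsSprungPair f p ap Lsharp Lflat) (hs0 : Lsharp ≠ 0) (hf0 : Lflat ≠ 0)
    (hGs : iwasawaToPowerSeries p Gs =
      PowerSeries.C ((ϖ : ℚ) : ℚ_[p]) * iwasawaToPowerSeries p (chromaticL Chroma.sharp Lsharp Lflat))
    (hGf : iwasawaToPowerSeries p Gf =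
      PowerSeries.C ((ϖ : ℚ) : ℚ_[p]) * iwasawaToPowerSeries p (chromaticL Chroma.flat Lsharp Lflat))
    (hJ : ∀ x ∈ Ideal.span ({Lsharp, Lflat} : Set (IwasawaAlgebra p)),
      invol p x ∈ Ideal.span ({Lsharp, Lflat} : Set (IwasawaAlgebra p)))
    (𝔭 : PrimeSpectrum (IwasawaAlgebra p)) (h𝔭 : 𝔭.asIdeal.height = 1)
    (hp𝔭 : (p : IwasawaAlgebra p) ∉ 𝔭.asIdeal) :
    Module.lengthAt (IwasawaAlgebra p) (I.H ⧸ Cs.Z) 𝔭 ≤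
        min (Module.lengthAt (IwasawaAlgebra p) (IwasawaAlgebra p ⧸ LinearMap.range Cs.colMap)
            (PrimeSpectrum.comap (invol p).toRingHom 𝔭))
          (Module.lengthAt (IwasawaAlgebra p) (IwasawaAlgebra p ⧸ LinearMap.range Cf.colMap)
            (PrimeSpectrum.comap (invol p).toRingHom 𝔭)) ↔
      Module.lengthAt (IwasawaAlgebra p) (I.H ⧸ Cs.Z) (PrimeSpectrum.comap (invol p).toRingHom 𝔭) ≤
        min (Module.lengthAt (IwasawaAlgebra p) (IwasawaAlgebra p ⧸ LinearMap.range Cs.colMap) 𝔭)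
          (Module.lengthAt (IwasawaAlgebra p) (IwasawaAlgebra p ⧸ LinearMap.range Cf.colMap) 𝔭) := by
  have h := zeta_add_localIndex_eq_comap_invol_contra_of_invol_mem W p Cs Cf hZ hirr hϖ hSP hs0 hf0 hGs hGf hJ 𝔭 h𝔭 hp𝔭
  have hcs : chromaticL Chroma.sharp Lsharp Lflat ≠ 0 := by rwa [chromaticL_sharp]
  have hGs0 : Gs ≠ 0 := normalised_ne_zero_orbit hϖ hcs hGs
  have h𝔮1 : (PrimeSpectrum.comap (invol p).toRingHom 𝔭).asIdeal.height = 1 := by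
    rw [Kato2004.height_comap_invol, h𝔭]
  exact ENat.orbit_le_iff_le_of_add_eq_add h (Cs.lengthAt_quotient_zeta_ne_top W p hirr hSP hcs hGs hGs0 𝔭 h𝔭)
    (localIndex_ne_top_contra W p Cs Cf hirr hSP hcs hGs hGs0 𝔭 h𝔭)
    (Cs.lengthAt_quotient_zeta_ne_top W p hirr hSP hcs hGs hGs0 _ h𝔮1)
    (localIndex_ne_top_contra W p Cs Cf hirr hSP hcs hGs hGs0 _ h𝔮1)

/-- **door ⟺ ORBIT ZETA INDEX ≤ COMMON-ZERO MULTIPLICITY, print keying.** Same situation: `k(𝔭) ≤ j(ι𝔭) ↔ k(𝔭) + k(ι𝔭) ≤ m(𝔭)`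
(`m(𝔭) = min(ℓ_𝔭 Λ/(Gs), ℓ_𝔭 Λ/(Gf))`; with the orbit window `m ≤ k + k′` of `…KatoSporadicLedgerOrbit` the door is the EQUALITY case
`k + k′ = m`). [cite: Kato2004Asterisque, Conj. 12.10 (p. 224), Thm. 12.6 (p. 222)] [cite: Sprung2012, Def. 6.1, §7.1, Thm. 7.14 (3)]
[cite: GreenbergLNM1716, §1] -/
theorem iotaDoor_contra_iff_zeta_add_zeta_comap_invol_le
    (Cs : SharpFlatColemanKatoDataContra W p f ϖ κ γ ι ap g c Chroma.sharp I)
    (Cf : SharpFlatColemanKatoDataContra W p f ϖ κ γ ι ap g c Chroma.flat I) (hZ : Cs.Z = Cf.Z)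
    (hirr : W.HasIrreducibleModPGaloisRep p) (hϖ : ϖ ≠ 0) {Lsharp Lflat Gs Gf : IwasawaAlgebra p}
    (hSP : IsSprungPair f p ap Lsharp Lflat) (hs0 : Lsharp ≠ 0) (hf0 : Lflat ≠ 0)
    (hGs : iwasawaToPowerSeries p Gs =
      PowerSeries.C ((ϖ : ℚ) : ℚ_[p]) * iwasawaToPowerSeries p (chromaticL Chroma.sharp Lsharp Lflat))
    (hGf : iwasawaToPowerSeries p Gf =
      PowerSeries.C ((ϖ : ℚ) : ℚ_[p]) * iwasawaToPowerSeries p (chromaticL Chroma.flat Lsharp Lflat))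
    (hJ : ∀ x ∈ Ideal.span ({Lsharp, Lflat} : Set (IwasawaAlgebra p)),
      invol p x ∈ Ideal.span ({Lsharp, Lflat} : Set (IwasawaAlgebra p)))
    (𝔭 : PrimeSpectrum (IwasawaAlgebra p)) (h𝔭 : 𝔭.asIdeal.height = 1)
    (hp𝔭 : (p : IwasawaAlgebra p) ∉ 𝔭.asIdeal) :
    Module.lengthAt (IwasawaAlgebra p) (I.H ⧸ Cs.Z) 𝔭 ≤
        min (Module.lengthAt (IwasawaAlgebra p) (IwasawaAlgebra p ⧸ LinearMap.range Cs.colMap)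
            (PrimeSpectrum.comap (invol p).toRingHom 𝔭))
          (Module.lengthAt (IwasawaAlgebra p) (IwasawaAlgebra p ⧸ LinearMap.range Cf.colMap)
            (PrimeSpectrum.comap (invol p).toRingHom 𝔭)) ↔
      Module.lengthAt (IwasawaAlgebra p) (I.H ⧸ Cs.Z) 𝔭 +
          Module.lengthAt (IwasawaAlgebra p) (I.H ⧸ Cs.Z) (PrimeSpectrum.comap (invol p).toRingHom 𝔭) ≤
        min (Module.lengthAt (IwasawaAlgebra p) (IwasawaAlgebra p ⧸ Ideal.span {Gs}) 𝔭)
          (Module.lengthAt (IwasawaAlgebra p) (IwasawaAlgebra p ⧸ Ideal.span {Gf}) 𝔭) := by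
  have h := zeta_add_localIndex_eq_comap_invol_contra_of_invol_mem W p Cs Cf hZ hirr hϖ hSP hs0 hf0 hGs hGf hJ 𝔭 h𝔭 hp𝔭
  have hcs : chromaticL Chroma.sharp Lsharp Lflat ≠ 0 := by rwa [chromaticL_sharp]
  have hcf : chromaticL Chroma.flat Lsharp Lflat ≠ 0 := by rwa [chromaticL_flat]
  have hGs0 : Gs ≠ 0 := normalised_ne_zero_orbit hϖ hcs hGs
  have h𝔮1 : (PrimeSpectrum.comap (invol p).toRingHom 𝔭).asIdeal.height = 1 := by
    rw [Kato2004.height_comap_invol, h𝔭]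
  rw [min_lengthAt_quotient_span_eq_zeta_add_localIndex_contra W p Cs Cf hZ hirr hSP hcs hcf hGs hGf 𝔭 h𝔭]
  exact ENat.orbit_le_iff_add_le_add_of_add_eq_add h (Cs.lengthAt_quotient_zeta_ne_top W p hirr hSP hcs hGs hGs0 𝔭 h𝔭)
    (localIndex_ne_top_contra W p Cs Cf hirr hSP hcs hGs hGs0 𝔭 h𝔭)
    (Cs.lengthAt_quotient_zeta_ne_top W p hirr hSP hcs hGs hGs0 _ h𝔮1)
    (localIndex_ne_top_contra W p Cs Cf hirr hSP hcs hGs hGs0 _ h𝔮1)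

/-- **residue(𝔭) ⟺ residue(ι𝔭), print keying.** Same situation: the registered residue hypothesis `j(ι𝔭) < k(𝔭)` of
`stub_iotaResidueContra` / `stub_iotaResidueCyclotomicContra` holds at `𝔭` iff it holds at `ι𝔭` (`j(𝔭) < k(ι𝔭)`); in particular inside
the residue BOTH zeta indices are positive. [cite: Kato2004Asterisque, Conj. 12.10 (p. 224)] [cite: Sprung2012, Main Conj. 7.21 (p. 1505)]
[cite: GreenbergLNM1716, §1] -/
theorem iotaResidue_contra_iff_comap_invol
    (Cs : SharpFlatColemanKatoDataContra W p f ϖ κ γ ι ap g c Chroma.sharp I)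
    (Cf : SharpFlatColemanKatoDataContra W p f ϖ κ γ ι ap g c Chroma.flat I) (hZ : Cs.Z = Cf.Z)
    (hirr : W.HasIrreducibleModPGaloisRep p) (hϖ : ϖ ≠ 0) {Lsharp Lflat Gs Gf : IwasawaAlgebra p}
    (hSP : IsSprungPair f p ap Lsharp Lflat) (hs0 : Lsharp ≠ 0) (hf0 : Lflat ≠ 0)
    (hGs : iwasawaToPowerSeries p Gs =
      PowerSeries.C ((ϖ : ℚ) : ℚ_[p]) * iwasawaToPowerSeries p (chromaticL Chroma.sharp Lsharp Lflat))
    (hGf : iwasawaToPowerSeries p Gf =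
      PowerSeries.C ((ϖ : ℚ) : ℚ_[p]) * iwasawaToPowerSeries p (chromaticL Chroma.flat Lsharp Lflat))
    (hJ : ∀ x ∈ Ideal.span ({Lsharp, Lflat} : Set (IwasawaAlgebra p)),
      invol p x ∈ Ideal.span ({Lsharp, Lflat} : Set (IwasawaAlgebra p)))
    (𝔭 : PrimeSpectrum (IwasawaAlgebra p)) (h𝔭 : 𝔭.asIdeal.height = 1)
    (hp𝔭 : (p : IwasawaAlgebra p) ∉ 𝔭.asIdeal) :
    min (Module.lengthAt (IwasawaAlgebra p) (IwasawaAlgebra p ⧸ LinearMap.range Cs.colMap)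
            (PrimeSpectrum.comap (invol p).toRingHom 𝔭))
          (Module.lengthAt (IwasawaAlgebra p) (IwasawaAlgebra p ⧸ LinearMap.range Cf.colMap)
            (PrimeSpectrum.comap (invol p).toRingHom 𝔭)) <
        Module.lengthAt (IwasawaAlgebra p) (I.H ⧸ Cs.Z) 𝔭 ↔
      min (Module.lengthAt (IwasawaAlgebra p) (IwasawaAlgebra p ⧸ LinearMap.range Cs.colMap) 𝔭)
          (Module.lengthAt (IwasawaAlgebra p) (IwasawaAlgebra p ⧸ LinearMap.range Cf.colMap) 𝔭) <
        Module.lengthAt (IwasawaAlgebra p) (I.H ⧸ Cs.Z) (PrimeSpectrum.comap (invol p).toRingHom 𝔭) := by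
  rw [← not_le, ← not_le, not_iff_not]
  exact iotaDoor_contra_iff_comap_invol W p Cs Cf hZ hirr hϖ hSP hs0 hf0 hGs hGf hJ 𝔭 h𝔭 hp𝔭

/-- **residue ⟺ `m < k + k′`, print keying.** Same situation: `j(ι𝔭) < k(𝔭) ↔ m(𝔭) < k(𝔭) + k(ι𝔭)` — the registered residue is the
set of common-zero `ι`-ORBITS whose total zeta index EXCEEDS the common-zero multiplicity.
[cite: Kato2004Asterisque, Conj. 12.10 (p. 224)] [cite: Sprung2012, Def. 6.1, Main Conj. 7.21 (p. 1505)] [cite: GreenbergLNM1716, §1] -/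
theorem iotaResidue_contra_iff_lt_zeta_add_zeta_comap_invol
    (Cs : SharpFlatColemanKatoDataContra W p f ϖ κ γ ι ap g c Chroma.sharp I)
    (Cf : SharpFlatColemanKatoDataContra W p f ϖ κ γ ι ap g c Chroma.flat I) (hZ : Cs.Z = Cf.Z)
    (hirr : W.HasIrreducibleModPGaloisRep p) (hϖ : ϖ ≠ 0) {Lsharp Lflat Gs Gf : IwasawaAlgebra p}
    (hSP : IsSprungPair f p ap Lsharp Lflat) (hs0 : Lsharp ≠ 0) (hf0 : Lflat ≠ 0)
    (hGs : iwasawaToPowerSeries p Gs =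
      PowerSeries.C ((ϖ : ℚ) : ℚ_[p]) * iwasawaToPowerSeries p (chromaticL Chroma.sharp Lsharp Lflat))
    (hGf : iwasawaToPowerSeries p Gf =
      PowerSeries.C ((ϖ : ℚ) : ℚ_[p]) * iwasawaToPowerSeries p (chromaticL Chroma.flat Lsharp Lflat))
    (hJ : ∀ x ∈ Ideal.span ({Lsharp, Lflat} : Set (IwasawaAlgebra p)),
      invol p x ∈ Ideal.span ({Lsharp, Lflat} : Set (IwasawaAlgebra p)))
    (𝔭 : PrimeSpectrum (IwasawaAlgebra p)) (h𝔭 : 𝔭.asIdeal.height = 1)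
    (hp𝔭 : (p : IwasawaAlgebra p) ∉ 𝔭.asIdeal) :
    min (Module.lengthAt (IwasawaAlgebra p) (IwasawaAlgebra p ⧸ LinearMap.range Cs.colMap)
            (PrimeSpectrum.comap (invol p).toRingHom 𝔭))
          (Module.lengthAt (IwasawaAlgebra p) (IwasawaAlgebra p ⧸ LinearMap.range Cf.colMap)
            (PrimeSpectrum.comap (invol p).toRingHom 𝔭)) <
        Module.lengthAt (IwasawaAlgebra p) (I.H ⧸ Cs.Z) 𝔭 ↔
      min (Module.lengthAt (IwasawaAlgebra p) (IwasawaAlgebra p ⧸ Ideal.span {Gs}) 𝔭)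
          (Module.lengthAt (IwasawaAlgebra p) (IwasawaAlgebra p ⧸ Ideal.span {Gf}) 𝔭) <
        Module.lengthAt (IwasawaAlgebra p) (I.H ⧸ Cs.Z) 𝔭 +
          Module.lengthAt (IwasawaAlgebra p) (I.H ⧸ Cs.Z) (PrimeSpectrum.comap (invol p).toRingHom 𝔭) := by
  rw [← not_le, ← not_le, not_iff_not]
  exact iotaDoor_contra_iff_zeta_add_zeta_comap_invol_le W p Cs Cf hZ hirr hϖ hSP hs0 hf0 hGs hGf hJ 𝔭 h𝔭 hp𝔭

/-- **A common zero whose MIRROR prime carries no zeta index is inside the door, print keying.** Same situation: `k(ι𝔭) = 0 ⟹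
k(𝔭) ≤ j(ι𝔭)` (indeed `j(ι𝔭) = m(𝔭) ≥ k(𝔭)`). [cite: Kato2004Asterisque, Conj. 12.10 (p. 224), Thm. 12.6 (p. 222)] [cite: GreenbergLNM1716, §1] -/
theorem iotaDoor_contra_of_zeta_comap_invol_eq_zero
    (Cs : SharpFlatColemanKatoDataContra W p f ϖ κ γ ι ap g c Chroma.sharp I)
    (Cf : SharpFlatColemanKatoDataContra W p f ϖ κ γ ι ap g c Chroma.flat I) (hZ : Cs.Z = Cf.Z)
    (hirr : W.HasIrreducibleModPGaloisRep p) (hϖ : ϖ ≠ 0) {Lsharp Lflat Gs Gf : IwasawaAlgebra p}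
    (hSP : IsSprungPair f p ap Lsharp Lflat) (hs0 : Lsharp ≠ 0) (hf0 : Lflat ≠ 0)
    (hGs : iwasawaToPowerSeries p Gs =
      PowerSeries.C ((ϖ : ℚ) : ℚ_[p]) * iwasawaToPowerSeries p (chromaticL Chroma.sharp Lsharp Lflat))
    (hGf : iwasawaToPowerSeries p Gf =
      PowerSeries.C ((ϖ : ℚ) : ℚ_[p]) * iwasawaToPowerSeries p (chromaticL Chroma.flat Lsharp Lflat))
    (hJ : ∀ x ∈ Ideal.span ({Lsharp, Lflat} : Set (IwasawaAlgebra p)),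
      invol p x ∈ Ideal.span ({Lsharp, Lflat} : Set (IwasawaAlgebra p)))
    (𝔭 : PrimeSpectrum (IwasawaAlgebra p)) (h𝔭 : 𝔭.asIdeal.height = 1)
    (hp𝔭 : (p : IwasawaAlgebra p) ∉ 𝔭.asIdeal)
    (hk' : Module.lengthAt (IwasawaAlgebra p) (I.H ⧸ Cs.Z) (PrimeSpectrum.comap (invol p).toRingHom 𝔭) = 0) :
    Module.lengthAt (IwasawaAlgebra p) (I.H ⧸ Cs.Z) 𝔭 ≤
        min (Module.lengthAt (IwasawaAlgebra p) (IwasawaAlgebra p ⧸ LinearMap.range Cs.colMap)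
            (PrimeSpectrum.comap (invol p).toRingHom 𝔭))
          (Module.lengthAt (IwasawaAlgebra p) (IwasawaAlgebra p ⧸ LinearMap.range Cf.colMap)
            (PrimeSpectrum.comap (invol p).toRingHom 𝔭)) := by
  have h := zeta_add_localIndex_eq_comap_invol_contra_of_invol_mem W p Cs Cf hZ hirr hϖ hSP hs0 hf0 hGs hGf hJ 𝔭 h𝔭 hp𝔭
  rw [hk'] at h
  exact ENat.orbit_le_of_add_eq_zero_add h

end Package

end Summit.BirchSwinnertonDyer.BirchSwinnertonDyer.Theorems.ChromaticCommonZeros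

end
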